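import Summits.HodgeConjecture.HodgeConjecture.Theorems.F0LD2ThetaTensorClasses
import Literature.NumberTheory.GelbartRogawski1991.UnitaryDualPairWeilCoinvariantsSmooth
import HarnessLib

set_option Elab.async false

/-!
# Crux `HLiu418`, line LD1 — (Gβ2-vi) LEVEL EXISTS: every finite test function `Φ_f` is fixed by the finite Weil representation of the
# CM line pair `U(diag dV) × U(⟨a⟩)` on a compact open subgroup of `U(diag dV)(𝔸_{L⁺,f})` (THEOREMS ONLY — a CITATION of ★ smoothness)

Cell hodgecm-mathlib, FLOOR 0, programme-6 line LD1 (socket `stub_S1_facts`, #73 E1θhol), LD1-p01 (g2), brick (Gβ2-vi) of LD1-plan's (I′) GERM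
ROAD; `--supports stmt-HodgeConjecture-24832`.  Namespace `Summit.HodgeConjecture.HodgeConjecture.Cruxes.HLiu418.F0LD1ThetaClassLevelExists`.
KERNEL ONLY: theorems; no definition, no named fact, no `sorry`, no instance, no notation.  Nothing of [Liu2021] is asserted; HC_CM is proved
only modulo the 7 printed citations (2 remaining: hLiu418 = stmt-HodgeConjecture-24832, h413 = stmt-HodgeConjecture-24833) until rung 0 closes;
count-neutral.

THE POINT.  The census asked for by LD1-plan (DEALS #6 (3)) finds the brick IN THE TREE BY NAME: ★
`WeilCoinv.exists_isOpen_isCompact_forall_finPairRepV_apply_eq_self` ([GelbartRogawski1991, §3.1 p. 454]: the finite Weil representation of a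
unitary dual pair with a continuous compatible splitting is SMOOTH — every `v ∈ 𝒮(𝔸_f^n)` is fixed by a principal congruence subgroup, which is
compact open), with the continuity of the `χ`-splitting at the line ★ `continuous_pairSplitting_chiSplittingLine` and its compatibility ★
`isCompatible_chiSplittingLine`.  This file only SPECIALISES it to the tokens of the LD theta road (★ `F0LD2ThetaTensorClasses`: the finite
representation `finPairRep … (isCompatible_chiSplittingLine …)` of `U(diag dV)(𝔸_f) × U(⟨a⟩)(𝔸_f)` at the points `(k, 1)`):

* `exists_isOpen_isCompact_forall_finPairRep_eq_self` — `∀ Φ_f, ∃ K ≤ U(diag dV)(𝔸_{L⁺,f})` compact open with `ω_f(k, 1) Φ_f = Φ_f` for all `k ∈ K`;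
* `exists_isOpen_isCompact_forall_forall_finPairRep_eq_self` — the same for a FINITE family `Φ_f^{(i)}` with ONE common `K` (intersection of
  finitely many open subgroups is open; a closed subgroup of a compact one is compact).

HONEST SCOPE.  A citation in the road's currency, no new mathematics.  Nothing of [Liu2021] is asserted; no book row moves by this file alone.

## References
* [GelbartRogawski1991] S. Gelbart, J. Rogawski, *L-functions and Fourier–Jacobi coefficients for the unitary group U(3)*, Invent. Math. 105
  (1991), §3.1 p. 454, Prop. 3.1.1 p. 455.
* [Weil1964] A. Weil, Acta Math. 111 (1964), Chap. III n° 37–38 pp. 188–190.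
-/

set_option autoImplicit false
-- the mandated namespace has the single-problem summit's repeated segment (`HodgeConjecture.HodgeConjecture`)
set_option linter.dupNamespace false

noncomputable section

open NumberField MeasureTheory IsDedekindDomain
open scoped Matrix Kronecker ComplexOrder ENNReal SchwartzMap TensorProduct Classical


open _root_.MeasureTheory
open Literature.NumberTheory.Automorphic Literature.NumberTheory.Automorphic.UnitaryGroup
open Literature.NumberTheory.Automorphic.UnitaryGroup.CotangentForms
open Literature.NumberTheory.Automorphic.IdeleClassGroup
open Literature.NumberTheory.Automorphic.Liu2021
open Literature.NumberTheory.Automorphic.Liu2021.Def411WeilCarriers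
open Literature.NumberTheory.Automorphic.Liu2021.Def411WeilCarriersDoubling
open Literature.NumberTheory.GelbartRogawski1991 Literature.NumberTheory.GelbartRogawski1991.UnitaryDualPair
open Literature.NumberTheory.GelbartRogawski1991.UnitaryDualPair.WeilCoinv
open Literature.NumberTheory.Weil1964
open Literature.RepresentationTheory Literature.RepresentationTheory.Liu2021
open Literature.RepresentationTheory.CompactGroups
open Literature.RepresentationTheory.HeisenbergGroup
open Summit.HodgeConjecture.HodgeConjecture.Cruxes.HLiu418.F0LD1ThetaTransportKit
open scoped SchwartzMap TensorProduct Classical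

namespace Summit.HodgeConjecture.HodgeConjecture.Cruxes.HLiu418.F0LD1ThetaClassLevelExists

variable (L : Type) [Field L] [NumberField L] [IsCMField L] (N : ℕ)
  {n' : ℕ} (e₁ : Fin N × Fin 1 ≃ Fin n') (dV : Fin N → L) (hdV : ∀ i, IsCMField.complexConj L (dV i) = dV i)
  (hdV0 : ∀ i, dV i ≠ 0)
  (μ : Literature.NumberTheory.Automorphic.IdeleClassGroup L →ₜ* Circle) (hμ : IsConjugateSymplectic L μ) (a : (↥(maximalRealSubfield L))ˣ)

/-- **(Gβ2-vi) LEVEL EXISTS**: every finite test function `Φ_f ∈ 𝒮(𝔸_{L⁺,f}^{N×1})` is fixed by the finite Weil representation `ω_f(k, 1)` of the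
CM line pair (at the `μ`-attached splitting) for all `k` in some COMPACT OPEN subgroup `K ≤ U(diag dV)(𝔸_{L⁺,f})` (★
`WeilCoinv.exists_isOpen_isCompact_forall_finPairRepV_apply_eq_self`; `finPairRepV k = finPairRep (k, 1)` by definition).
[cite: GelbartRogawski1991, §3.1 p. 454] -/
theorem exists_isOpen_isCompact_forall_finPairRep_eq_self (Φf : FinSB (↥(maximalRealSubfield L)) (Fin N × Fin 1)) :
    ∃ K : Subgroup (finAdelic (↥(maximalRealSubfield L)) L (IsCMField.complexConj L) N (Matrix.diagonal dV)),
      IsOpen (K : Set (finAdelic (↥(maximalRealSubfield L)) L (IsCMField.complexConj L) N (Matrix.diagonal dV))) ∧ IsCompact (K : Set (finAdelic (↥(maximalRealSubfield L)) L (IsCMField.complexConj L) N (Matrix.diagonal dV))) ∧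
      ∀ k ∈ K, finPairRep (↥(maximalRealSubfield L)) L (IsCMField.complexConj L) N 1 e₁ (Matrix.diagonal dV) (JW (↥(maximalRealSubfield L)) L a)
        (complexConj_imagUnit L) (imagUnit_ne_zero L) (imagUnit_mul_self L) (realDiagonal_isSymm L dV hdV) (isSymm_TW (↥(maximalRealSubfield L)) a)
        (isUnit_det_realDiagonal L dV hdV hdV0) (isUnit_det_TW (↥(maximalRealSubfield L)) a) (realDiagonal_map L dV hdV).symm
        (JW_eq (↥(maximalRealSubfield L)) L a)
        (isCompatible_chiSplittingLine L e₁ dV hdV hdV0 (toHeckeCharacter L μ) (isUnitary_toHeckeCharacter L μ)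
          ((isOscillatorChar_toHeckeCharacter_iff μ).mpr hμ) (TW (↥(maximalRealSubfield L)) a) (isSymm_TW (↥(maximalRealSubfield L)) a)
          (isUnit_det_TW (↥(maximalRealSubfield L)) a) (JW (↥(maximalRealSubfield L)) L a) (JW_eq (↥(maximalRealSubfield L)) L a)) (k, 1) Φf = Φf :=
  WeilCoinv.exists_isOpen_isCompact_forall_finPairRepV_apply_eq_self (↥(maximalRealSubfield L)) L (IsCMField.complexConj L) N 1 e₁
    (Matrix.diagonal dV) (JW (↥(maximalRealSubfield L)) L a) (complexConj_imagUnit L) (imagUnit_ne_zero L) (imagUnit_mul_self L)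
    (realDiagonal_isSymm L dV hdV) (isSymm_TW (↥(maximalRealSubfield L)) a) (isUnit_det_realDiagonal L dV hdV hdV0)
    (isUnit_det_TW (↥(maximalRealSubfield L)) a) (realDiagonal_map L dV hdV).symm (JW_eq (↥(maximalRealSubfield L)) L a)
    (continuous_pairSplitting_chiSplittingLine L e₁ dV hdV hdV0 (toHeckeCharacter L μ) (isUnitary_toHeckeCharacter L μ)
      ((isOscillatorChar_toHeckeCharacter_iff μ).mpr hμ) (TW (↥(maximalRealSubfield L)) a) (isUnit_det_TW (↥(maximalRealSubfield L)) a)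
      (JW (↥(maximalRealSubfield L)) L a) (JW_eq (↥(maximalRealSubfield L)) L a))
    (isCompatible_chiSplittingLine L e₁ dV hdV hdV0 (toHeckeCharacter L μ) (isUnitary_toHeckeCharacter L μ)
      ((isOscillatorChar_toHeckeCharacter_iff μ).mpr hμ) (TW (↥(maximalRealSubfield L)) a) (isSymm_TW (↥(maximalRealSubfield L)) a)
      (isUnit_det_TW (↥(maximalRealSubfield L)) a) (JW (↥(maximalRealSubfield L)) L a) (JW_eq (↥(maximalRealSubfield L)) L a)) Φf

/-- **(Gβ2-vi) for a finite family**: finitely many finite test functions `Φ_f^{(i)}` are SIMULTANEOUSLY fixed by `ω_f(k, 1)` for all `k` in one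
compact open subgroup `K ≤ U(diag dV)(𝔸_{L⁺,f})` (the intersection of the individual levels). [cite: GelbartRogawski1991, §3.1 p. 454] -/
theorem exists_isOpen_isCompact_forall_forall_finPairRep_eq_self {A : Type*} [Finite A]
    (Φf : A → FinSB (↥(maximalRealSubfield L)) (Fin N × Fin 1)) :
    ∃ K : Subgroup (finAdelic (↥(maximalRealSubfield L)) L (IsCMField.complexConj L) N (Matrix.diagonal dV)),
      IsOpen (K : Set (finAdelic (↥(maximalRealSubfield L)) L (IsCMField.complexConj L) N (Matrix.diagonal dV))) ∧ IsCompact (K : Set (finAdelic (↥(maximalRealSubfield L)) L (IsCMField.complexConj L) N (Matrix.diagonal dV))) ∧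
      ∀ i, ∀ k ∈ K, finPairRep (↥(maximalRealSubfield L)) L (IsCMField.complexConj L) N 1 e₁ (Matrix.diagonal dV) (JW (↥(maximalRealSubfield L)) L a)
        (complexConj_imagUnit L) (imagUnit_ne_zero L) (imagUnit_mul_self L) (realDiagonal_isSymm L dV hdV) (isSymm_TW (↥(maximalRealSubfield L)) a)
        (isUnit_det_realDiagonal L dV hdV hdV0) (isUnit_det_TW (↥(maximalRealSubfield L)) a) (realDiagonal_map L dV hdV).symm
        (JW_eq (↥(maximalRealSubfield L)) L a)
        (isCompatible_chiSplittingLine L e₁ dV hdV hdV0 (toHeckeCharacter L μ) (isUnitary_toHeckeCharacter L μ)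
          ((isOscillatorChar_toHeckeCharacter_iff μ).mpr hμ) (TW (↥(maximalRealSubfield L)) a) (isSymm_TW (↥(maximalRealSubfield L)) a)
          (isUnit_det_TW (↥(maximalRealSubfield L)) a) (JW (↥(maximalRealSubfield L)) L a) (JW_eq (↥(maximalRealSubfield L)) L a)) (k, 1) (Φf i) = Φf i := by
  classical
  choose K hKo hKc hfix using fun i =>
    exists_isOpen_isCompact_forall_finPairRep_eq_self L N e₁ dV hdV hdV0 μ hμ a (Φf i)
  cases isEmpty_or_nonempty A with
  | inl hA =>
    -- no test function: any compact open subgroup works, e.g. the level of `0`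
    obtain ⟨K₀, hK₀o, hK₀c, -⟩ := exists_isOpen_isCompact_forall_finPairRep_eq_self L N e₁ dV hdV hdV0 μ hμ a 0
    exact ⟨K₀, hK₀o, hK₀c, fun i => (hA.false i).elim⟩
  | inr hA =>
    haveI := Fintype.ofFinite A
    obtain ⟨i₀⟩ := hA
    refine ⟨⨅ i, K i, ?_, ?_, fun i k hk => hfix i k (Subgroup.mem_iInf.1 hk i)⟩
    · -- a finite intersection of open subgroups is open
      have h : ((⨅ i, K i : Subgroup (finAdelic (↥(maximalRealSubfield L)) L (IsCMField.complexConj L) N (Matrix.diagonal dV))) : Set (finAdelic (↥(maximalRealSubfield L)) L (IsCMField.complexConj L) N (Matrix.diagonal dV))) = ⋂ i, (K i : Set (finAdelic (↥(maximalRealSubfield L)) L (IsCMField.complexConj L) N (Matrix.diagonal dV))) := by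
        ext x; simp
      rw [h]
      exact isOpen_iInter_of_finite hKo
    · -- a closed subset (an open subgroup is closed) of the compact `K i₀`
      have h : ((⨅ i, K i : Subgroup (finAdelic (↥(maximalRealSubfield L)) L (IsCMField.complexConj L) N (Matrix.diagonal dV))) : Set (finAdelic (↥(maximalRealSubfield L)) L (IsCMField.complexConj L) N (Matrix.diagonal dV))) = ⋂ i, (K i : Set (finAdelic (↥(maximalRealSubfield L)) L (IsCMField.complexConj L) N (Matrix.diagonal dV))) := by
        ext x; simp
      rw [h]
      refine (hKc i₀).of_isClosed_subset (isClosed_iInter fun i => (K i).isClosed_of_isOpen (hKo i)) ?_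
      exact Set.iInter_subset _ i₀

end Summit.HodgeConjecture.HodgeConjecture.Cruxes.HLiu418.F0LD1ThetaClassLevelExists

end
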